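import Summits.QuantumAdvantage.QuantumAdvantage.Theorems.CubicForrelationNearExactIsExactTwelveLevelFiveAlphaH4

/-!
# Crux `CubicForrelation.NearExactIsExact` (stmt-QuantumAdvantage-14043) — n = 12, open window, a LEVEL-5 side in CASE α: the sign bit `hb`
  has EVEN parametrised 4-flat sections on the odd hyperplane (relative degree `≤ 3`)

Certificate seat `b2b-cforr-cert` (gen 29).  HONEST FRAMING: kernel-checked finite-slice lemma (standard axioms) about cubic Boolean pairs on 12 bits;
it combines `tzw_alpha_H4par` (parity transfer across the hyperplane) with `tzw_A2_section4_even` (4-flat sections of the 8-flat `A₂` are even):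
in case α the sign bit `hb = [e₅ ≡ 3 (mod 4)]` is a RELATIVE CUBIC on `P` (PLAN-N12-WINDOW-ALPHA.md §A1; in the generic/rigid cases it was a
relative quadratic, `tzl5_hsd`).  NO value of `θ₁₂` claimed; NOT summit progress.

* `tzw_alpha_hb_cubic`: `#{ε ∈ 𝔽₂⁴ : hb(x ⊕ ε·a) = 1}` is even for `x ∈ P`, `a₀,…,a₃ ∈ V`, given the case-α data of `tza_window_alpha`
  (`{u' even} = c ⊕ V`, `{u' even, 4 ∤ e₅} = c ⊕ V₁`, `V₁ ⊆ V` xor-closed, `#V₁ = 256`).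

References: J. Ax (1964) / R. J. McEliece (1972); MacWilliams–Sloane (1977) Ch. 13 §3.  Axioms: the standard three.
-/

set_option linter.dupNamespace false -- D-0017: single-problem summit ⇒ `QuantumAdvantage.QuantumAdvantage` by design

noncomputable section

namespace Summit.QuantumAdvantage.QuantumAdvantage.Theorems.CubicForrelation.NearExactIsExact

open Finset
open Literature.Computability.QuantumComplexity
open Literature.Computability.QuantumComplexity.BuzetChailloux (bxor zeroVec bxor_bxor_cancel_left bxor_zeroVec zeroVec_bxor bxor_comm
  bxor_self)
open Literature.Computability.QuantumComplexity.DerivativeWalsh (W)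

/-- **In case α the sign bit is a relative cubic on `P`.**  Cubic `f, g` on 12 bits, `W_g = 32u'`, `P = {u' odd} = x₀ ⊕ V` (`#V = 2048`),
case-α data: `{u' even} = c ⊕ V`, `{u' even, 4 ∤ e₅} = c ⊕ V₁` with `V₁ ⊆ V` xor-closed, `#V₁ = 256`.  Then for `x ∈ P` and
`a₀,…,a₃ ∈ V` the number of `ε ∈ 𝔽₂⁴` with `hb(x ⊕ ε·a) = 1` is even. [this work] -/
theorem tzw_alpha_hb_cubic (f g : (Fin (6 + 6) → Bool) → Bool) (hf : IsDegLeFun 3 f) (hg : IsDegLeFun 3 g)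
    (u' : (Fin (6 + 6) → Bool) → ℤ) (hu' : ∀ x, W (fun y => signOf (g y)) x = (2 : ℝ) ^ 5 * (u' x : ℝ))
    (V : Finset (Fin (6 + 6) → Bool)) (x₀ : Fin (6 + 6) → Bool) (h0 : zeroVec ∈ V) (hadd : ∀ a ∈ V, ∀ b ∈ V, bxor a b ∈ V)
    (hcardV : #V = 2048) (hP : (univ.filter fun x : Fin (6 + 6) → Bool => Odd (u' x)) = V.image (bxor x₀))
    (hb : (Fin (6 + 6) → Bool) → Bool) (hhb : ∀ z, hb z = decide ((u' z - 2 * sZ (f z)) % 4 = 3))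
    (c : Fin (6 + 6) → Bool) (V₁ : Finset (Fin (6 + 6) → Bool)) (hsub : V₁ ⊆ V) (h1add : ∀ a ∈ V₁, ∀ b ∈ V₁, bxor a b ∈ V₁)
    (h1card : #V₁ = 256) (hPc : (univ.filter fun x : Fin (6 + 6) → Bool => ¬ Odd (u' x)) = V.image (bxor c))
    (hA2 : (univ.filter fun y : Fin (6 + 6) → Bool => ¬ Odd (u' y) ∧ ¬ (4 : ℤ) ∣ u' y - 2 * sZ (f y)) = V₁.image (bxor c))
    {x a₀ a₁ a₂ a₃ : Fin (6 + 6) → Bool} (hx : Odd (u' x)) (ha₀ : a₀ ∈ V) (ha₁ : a₁ ∈ V) (ha₂ : a₂ ∈ V) (ha₃ : a₃ ∈ V) :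
    Even #(univ.filter fun ε : Fin 4 → Bool => hb (fun j => x j ^^ decide (Odd #(univ.filter fun i => ε i && (![a₀, a₁, a₂, a₃] : Fin 4 → Fin (6 + 6) → Bool) i j))) = true) := by
  classical
  set P := univ.filter (fun x : Fin (6 + 6) → Bool => Odd (u' x)) with hPdef
  have hxP : x ∈ P := mem_filter.2 ⟨mem_univ _, hx⟩
  have hPV : ∀ x, x ∈ P → ∀ a ∈ V, bxor x a ∈ P := fun x hx a ha => fl1_coset_vadd hadd hP hx ha
  -- a transversal `t ∉ V`
  have huniv : #(univ : Finset (Fin (6 + 6) → Bool)) = 4096 := by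
    rw [card_univ, Fintype.card_fun, Fintype.card_bool, Fintype.card_fin]; norm_num
  obtain ⟨t, -, ht⟩ : ∃ t, t ∈ univ ∧ t ∉ V := exists_mem_notMem_of_card_lt_card (by rw [huniv, hcardV]; norm_num)
  have hpar := tzw_alpha_H4par f g hf hg u' hu' V x₀ h0 hadd hP hb hhb hx ha₀ ha₁ ha₂ ha₃ ht
  -- the parallel flat off `P`
  have ha : ∀ i, (![a₀, a₁, a₂, a₃] : Fin 4 → Fin (6 + 6) → Bool) i ∈ V := by intro i; fin_cases i <;> assumption
  have hin : ∀ ε : Fin 4 → Bool, (fun j => x j ^^ decide (Odd #(univ.filter fun i => ε i && (![a₀, a₁, a₂, a₃] : Fin 4 → Fin (6 + 6) → Bool) i j))) ∈ P := fun ε => fr_mem_flatPt4 V h0 (· ∈ P) hPV hxP _ ha ε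
  have hout : ∀ ε : Fin 4 → Bool, bxor (fun j => x j ^^ decide (Odd #(univ.filter fun i => ε i && (![a₀, a₁, a₂, a₃] : Fin 4 → Fin (6 + 6) → Bool) i j))) t ∉ P := fun ε => fl1_coset_out h0 hadd hP (hin ε) ht
  have hzP : bxor x t ∉ P := fl1_coset_out h0 hadd hP hxP ht
  have hz : bxor x t ∈ V.image (bxor c) := by
    rw [← hPc]; exact mem_filter.2 ⟨mem_univ _, fun h => hzP (mem_filter.2 ⟨mem_univ _, h⟩)⟩
  have hev := tzw_A2_section4_even V h0 hadd hcardV V₁ hsub h1add h1card c (bxor x t) hz (![a₀, a₁, a₂, a₃] : Fin 4 → Fin (6 + 6) → Bool) ha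
  -- identify the two off-`P` counts
  have hflat : ∀ ε : Fin 4 → Bool, (fun j => (bxor x t) j ^^ decide (Odd #(univ.filter fun i => ε i && (![a₀, a₁, a₂, a₃] : Fin 4 → Fin (6 + 6) → Bool) i j))) = bxor (fun j => x j ^^ decide (Odd #(univ.filter fun i => ε i && (![a₀, a₁, a₂, a₃] : Fin 4 → Fin (6 + 6) → Bool) i j))) t := by
    intro ε
    rw [ws_flatPt_eq_bxor (bxor x t) _ ε, ws_flatPt_eq_bxor x _ ε, iw_bxor_assoc, iw_bxor_assoc,
      bxor_comm t]
  have hset : (univ.filter fun ε : Fin 4 → Bool => (fun j => (bxor x t) j ^^ decide (Odd #(univ.filter fun i => ε i && (![a₀, a₁, a₂, a₃] : Fin 4 → Fin (6 + 6) → Bool) i j))) ∈ V₁.image (bxor c)) =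
      univ.filter fun ε : Fin 4 → Bool => ¬ (4 : ℤ) ∣ u' (bxor (fun j => x j ^^ decide (Odd #(univ.filter fun i => ε i && (![a₀, a₁, a₂, a₃] : Fin 4 → Fin (6 + 6) → Bool) i j))) t) - 2 * sZ (f (bxor (fun j => x j ^^ decide (Odd #(univ.filter fun i => ε i && (![a₀, a₁, a₂, a₃] : Fin 4 → Fin (6 + 6) → Bool) i j))) t)) := by
    refine filter_congr fun ε _ => ?_
    rw [hflat ε, ← hA2, mem_filter]
    have hne : ¬ Odd (u' (bxor (fun j => x j ^^ decide (Odd #(univ.filter fun i => ε i && (![a₀, a₁, a₂, a₃] : Fin 4 → Fin (6 + 6) → Bool) i j))) t)) := fun h => hout ε (mem_filter.2 ⟨mem_univ _, h⟩)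
    simp only [mem_univ, true_and]
    exact ⟨fun h => h.2, fun h => ⟨hne, h⟩⟩
  rw [hset] at hev
  exact (Nat.even_add.1 hpar).2 hev

end Summit.QuantumAdvantage.QuantumAdvantage.Theorems.CubicForrelation.NearExactIsExact

end
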